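import Literature.Topology.FourManifolds.HeegaardSplittingSelfIndexing
import Literature.Topology.FourManifolds.OneHandleStepExists
import HarnessLib

/-!
# The Lickorish–Wallace theorem from the Dehn–Lickorish twist theorem ALONE

Topic `Literature/Topology/FourManifolds`; proofs only (no definition, no named fact). Librarian
fact decomposition (`fact-decompose`, human 2026-08-16) of the budget-capped named fact
`Literature.Topology.FourManifolds.exists_isIntegralSurgeryLink` (**spc4.S22**, `SurgeryGluck.lean`:
every closed, connected, orientable smooth `3`-manifold is integral Dehn surgery on a link in
`S³` — W. B. R. Lickorish, Ann. of Math. 76 (1962), Thm. 2; A. H. Wallace, Canad. J. Math. 12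
(1960)).

State of the tree: `exists_isIntegralSurgeryLink_of_oneHandle_of_isDehnTwist`
(`HeegaardSplittingSelfIndexing.lean`) proves the theorem from the two named facts
`oneHandle_nonempty_diffeomorph` (L1, uniqueness of attaching one `1`-handle) and
`exists_isDehnTwist_isIsotopic_listProd` (F3, the Dehn–Lickorish theorem, Lickorish's Thm. 1), every
other printed ingredient (Heegaard splittings from a self-indexing Morse function, handlebody
classification, the genus-`g` splitting of `S³`, gluing uniqueness, one `±1` surgery per twist)
being a theorem; and L1 has meanwhile been DISCHARGED (`oneHandle_nonempty_diffeomorph_holds`,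
`OneHandleStepExists.lean`). Hence the decomposition of this fact has exactly one child, the
existing named fact F3:

* `exists_isIntegralSurgeryLink_holds_of : exists_isDehnTwist_isIsotopic_listProd →
  exists_isIntegralSurgeryLink` — the discharge `exists_isIntegralSurgeryLink_holds` is this theorem
  applied to `exists_isDehnTwist_isIsotopic_listProd_holds` once F3 (Lickorish 1962, Thm. 1: every
  orientation-preserving diffeomorphism of a closed orientable surface is isotopic to a product of
  Dehn twists) lands.

## References

* W. B. R. Lickorish, *A representation of orientable combinatorial 3-manifolds*, Ann. of Math. (2)
  76 (1962) 531–540: Thm. 1 (p. 536), Thm. 2 (p. 538) and its proof (pp. 538–540).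
  [LickorishAnnals1962]
* A. H. Wallace, *Modifications and cobounding manifolds*, Canad. J. Math. 12 (1960) 503–528.
* A. A. Kosinski, *Differential Manifolds* (1993), VI (6.6), (11.4)(c). [Kosinski1993]
-/

open scoped Manifold ContDiff Topology
open Set Function

noncomputable section

namespace Literature.Topology.FourManifolds

universe u

/-- **Lickorish–Wallace (`exists_isIntegralSurgeryLink`) from the Dehn–Lickorish theorem alone**:
with L1 discharged (`oneHandle_nonempty_diffeomorph_holds`), the tree's
`exists_isIntegralSurgeryLink_of_oneHandle_of_isDehnTwist` leaves exactly F3,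
`exists_isDehnTwist_isIsotopic_listProd` (Lickorish 1962, Thm. 1). Printed proof of Thm. 2
(pp. 538–540): Heegaard splitting `Y = H ∪_f H'`, the standard genus-`g` splitting of `S³`,
Thm. 1 factoring the regluing map into twists, one `±1` surgery per twist.
[cite: LickorishAnnals1962, Thm. 2 and its proof (pp. 538–540), Thm. 1 (p. 536)] -/
theorem exists_isIntegralSurgeryLink_holds_of (h₃ : exists_isDehnTwist_isIsotopic_listProd.{u}) :
    FourManifolds.exists_isIntegralSurgeryLink.{u} :=
  exists_isIntegralSurgeryLink_of_oneHandle_of_isDehnTwist oneHandle_nonempty_diffeomorph_holds h₃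

end Literature.Topology.FourManifolds

end
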